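import Mathlib
import Literature.NumberTheory.LFunctions.Zhang2022.Section5DeltaRapidDecay
import HarnessLib

/-!
# Zhang (2022), §5 / §7 (7.14): the `|t| ≥ X` tail of `∫ ‖δ(1+it)‖ dt`, kernel-checked

Topic `Literature/NumberTheory/LFunctions/Zhang2022` (Landau–Siegel audit tree; verdict-neutral).
Y. Zhang, *Discrete mean estimates and the Landau–Siegel zero*, arXiv:2211.02515v1 (2022)
[Zhang2022LandauSiegel] — **an unrefereed manuscript under adjudication** (cell `siegel-zhang`, D-0069).
Companion of `Section5DeltaRapidDecay` (GAP-LEDGER row G-adj2-2, DAG `Z22:(7.14)` /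
`Z22:Prop7.1.pf.b-error` [Z22 p.38, tex L2009–2024], inherited by `Z22:(14.5)`): the form of the rapid
decay of `δ(1+it)` that the `|t| > D` part of the (7.14) integral consumes directly —

* `Lemma53.continuous_delta514_line` — `t ↦ δ(σ+it)` is continuous for `σ > 0` (from the tree's
  holomorphy `Lemma53.differentiableOn_delta514`), so the Mellin-side integrands of (7.14) are measurable;
* `Lemma53.integrableOn_and_integral_norm_le_of_abs_ge` — a generic tail lemma: if `‖f t‖ ≤ A|t|⁻ʲ`
  for `|t| ≥ X ≥ 1` (`j ≥ 2`) and `f` is measurable, then `f` is integrable on `{X ≤ |t|}` and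
  `∫_{X ≤ |t|} ‖f‖ ≤ 2πA·X^{2−j}` (majorant `2AX^{2−j}(1+t²)⁻¹`);
* `Skeleton.continuous_deltaW_line`, `Skeleton.deltaW_tail_integral_le` — **for every `j` there are
  `c, C` with, for all large `D` and every `X ≥ t₀^{1.03}`: `t ↦ δ(1+it)` is integrable on `{X ≤ |t|}`
  and `∫_{X ≤ |t|} ‖δ(1+it)‖ dt ≤ C·𝓛ᶜ·(t₀^{1.03})^{j+2}·X^{−j}`** (take `X = D`: the tail is
  `≪ 𝓛^{c+534.6(j+2)}D^{−j}`, negligible against any `D^{−c}`);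
* `Lemma53.mellin_Delta510_eq`, `Lemma53.mellinConvergent_Delta510`, `Skeleton.integrable_deltaW_line`,
  `Skeleton.DeltaW_eq_mellinInv` — `δ` is Mathlib's `mellin Δ`, `t ↦ δ(1+it)` is integrable on `ℝ`
  for large `D`, and **`Δ(x) = (1/2π)∫ x^{−(1+it)} δ(1+it) dt` (`x > 0`)** — "By the Mellin transform"
  of (7.14)/(14.5), exact (Mathlib `mellinInv_mellin_eq`);
* `Skeleton.norm_deltaW_line_le`, `Skeleton.integral_norm_deltaW_line_le` — Lemma 5.4 (i) on `σ = 1`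
  at the manuscript's parameters (tree `Lemma53.norm_delta514_le_explicit`): `‖δ(1+it)‖ ≤ C𝓛⁵¹⁹⁰/(1+t²)`,
  `∫_ℝ‖δ(1+it)‖ ≤ πC𝓛⁵¹⁹⁰` (`D ≥ 3`) — the `|t| ≤ D` companion of the tail bound.

NOT here: the `|t| ≤ D` part ((7.14) proper, Lemma 5.4 (i) and Lemma 5.6 — tree `Skeleton.lemma56_holds`),
or any claim about Prop. 7.1 / 14.1, Theorems 1–2, or Landau–Siegel zeros.

## References

* Y. Zhang, arXiv:2211.02515v1 (2022), §5 (5.14), Lemma 5.4 (i) p.28; §7 (7.14) p.38.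
  [cite: Zhang2022LandauSiegel, §5 (5.14); §7 (7.14)]
-/

noncomputable section

open Complex Real Set MeasureTheory Filter Topology

namespace Literature.NumberTheory.LFunctions.Zhang2022

namespace Lemma53

/-- **`t ↦ δ(σ + it)` is continuous for `σ > 0`** (`L₂ ≥ 1`), from the holomorphy of `δ` on
`{Re s > 0}` (`differentiableOn_delta514`). [cite: Zhang2022LandauSiegel, §5 (5.14)] -/
theorem continuous_delta514_line {L₂ : ℝ} (hL : 1 ≤ L₂) (t₀ : ℝ) {σ : ℝ} (hσ : 0 < σ) :
    Continuous fun t : ℝ => delta514 L₂ t₀ (σ + t * I) :=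
  (differentiableOn_delta514 hL t₀).continuousOn.comp_continuous (by fun_prop) fun t => by
    simp [hσ]

/-- **Generic tail lemma**: if `f` is (a.e. strongly) measurable and `‖f t‖ ≤ A|t|⁻ʲ` whenever
`|t| ≥ X`, with `X ≥ 1`, `j ≥ 2`, `A ≥ 0`, then `f` is integrable on `{t | X ≤ |t|}` and
`∫_{X ≤ |t|} ‖f t‖ dt ≤ 2πA·X^{2−j}` (majorant `2AX^{2−j}(1+t²)⁻¹`, `∫(1+t²)⁻¹ = π`). [folklore] -/
private theorem integrableOn_and_integral_norm_le_of_abs_ge {E : Type*} [NormedAddCommGroup E]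
    {f : ℝ → E} (hf : AEStronglyMeasurable f) {X A : ℝ} (hX : 1 ≤ X) (hA : 0 ≤ A) {j : ℕ}
    (hj : 2 ≤ j) (hb : ∀ t : ℝ, X ≤ |t| → ‖f t‖ ≤ A * |t| ^ (-(j : ℝ))) :
    IntegrableOn f {t : ℝ | X ≤ |t|} ∧
      ∫ t in {t : ℝ | X ≤ |t|}, ‖f t‖ ≤ 2 * π * A * X ^ (2 - (j : ℝ)) := by
  set S : Set ℝ := {t : ℝ | X ≤ |t|} with hS
  have hSm : MeasurableSet S := (isClosed_le continuous_const continuous_abs).measurableSet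
  set m : ℝ → ℝ := fun t => 2 * A * X ^ (2 - (j : ℝ)) * (1 + t ^ 2)⁻¹ with hm
  have hXj : 0 ≤ X ^ (2 - (j : ℝ)) := Real.rpow_nonneg (by linarith) _
  have hmi : Integrable m := integrable_inv_one_add_sq.const_mul _
  have hm0 : ∀ t, 0 ≤ m t := fun t => by rw [hm]; positivity
  -- the pointwise comparison on `S`
  have hpt : ∀ t ∈ S, ‖f t‖ ≤ m t := by
    intro t ht
    have hXt : X ≤ |t| := ht
    have ht0 : 0 < |t| := by linarith
    have hj2 : (2 : ℝ) - j ≤ 0 := by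
      have : (2 : ℝ) ≤ j := by exact_mod_cast hj
      linarith
    have h1 : |t| ^ (-(j : ℝ)) = |t| ^ (2 - (j : ℝ)) * |t| ^ (-2 : ℝ) := by
      rw [← Real.rpow_add ht0]; congr 1; ring
    have h2 : |t| ^ (2 - (j : ℝ)) ≤ X ^ (2 - (j : ℝ)) :=
      Real.rpow_le_rpow_of_nonpos (by linarith) hXt hj2
    have h3 : |t| ^ (-2 : ℝ) ≤ 2 * (1 + t ^ 2)⁻¹ := by
      have ht2 : 1 ≤ t ^ 2 := by nlinarith [sq_abs t]
      rw [Real.rpow_neg ht0.le, Real.rpow_two, sq_abs,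
        show (2 : ℝ) * (1 + t ^ 2)⁻¹ = ((1 + t ^ 2) / 2)⁻¹ by rw [inv_div]; ring]
      exact inv_anti₀ (by positivity) (by linarith)
    calc ‖f t‖ ≤ A * |t| ^ (-(j : ℝ)) := hb t hXt
      _ = A * (|t| ^ (2 - (j : ℝ)) * |t| ^ (-2 : ℝ)) := by rw [h1]
      _ ≤ A * (X ^ (2 - (j : ℝ)) * (2 * (1 + t ^ 2)⁻¹)) := by
          refine mul_le_mul_of_nonneg_left ?_ hA
          exact mul_le_mul h2 h3 (Real.rpow_nonneg ht0.le _) hXj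
      _ = m t := by rw [hm]; ring
  have hint : IntegrableOn f S :=
    Integrable.mono' hmi.integrableOn (hf.restrict)
      ((ae_restrict_mem hSm).mono fun t ht => hpt t ht)
  refine ⟨hint, ?_⟩
  calc ∫ t in S, ‖f t‖ ≤ ∫ t in S, m t :=
        setIntegral_mono_on hint.norm hmi.integrableOn hSm hpt
    _ ≤ ∫ t, m t := setIntegral_le_integral hmi (Eventually.of_forall hm0)
    _ = 2 * π * A * X ^ (2 - (j : ℝ)) := by
        rw [hm, MeasureTheory.integral_const_mul, integral_univ_inv_one_add_sq]; ring

/-- `mellin Δ = δ`: the tree's (5.14) `δ(s) = ∫₀^∞ Δ(x)x^{s−1}dx` is Mathlib's Mellin transform of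
`Δ` (`mellin f s = ∫_{Ioi 0} t^{s−1} • f t`). [cite: Zhang2022LandauSiegel, §5 (5.14)] -/
theorem mellin_Delta510_eq (L₂ t₀ : ℝ) (s : ℂ) : mellin (Delta510 L₂ t₀) s = delta514 L₂ t₀ s := by
  rw [mellin, delta514]
  exact setIntegral_congr_fun measurableSet_Ioi fun x _ => by simp [smul_eq_mul, mul_comm]

/-- The Mellin integral of `Δ` converges absolutely for `Re s > 0` (`L₂ ≥ 1`).
[cite: Zhang2022LandauSiegel, §5 (5.14)] -/
theorem mellinConvergent_Delta510 {L₂ : ℝ} (hL : 1 ≤ L₂) (t₀ : ℝ) {s : ℂ} (hs : 0 < s.re) :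
    MellinConvergent (Delta510 L₂ t₀) s :=
  (integrableOn_Delta510_mul_cpow hL t₀ hs).congr_fun
    (fun x _ => by simp [smul_eq_mul, mul_comm]) measurableSet_Ioi

end Lemma53

namespace Skeleton

/-- **`t ↦ δ(1+it)` is continuous** at the manuscript's parameters, for `D ≥ 3` (`𝓛₂ ≥ 1`).
[cite: Zhang2022LandauSiegel, §5 (5.14)] -/
theorem continuous_deltaW_line {D : ℕ} (hD : 3 ≤ D) :
    Continuous fun t : ℝ => deltaW D (1 + t * I) := by
  have hℓ1 : 1 ≤ ell D := by
    rw [ell, Real.le_log_iff_exp_le (by exact_mod_cast (show 0 < D by omega))]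
    have h3 : (3 : ℝ) ≤ D := by exact_mod_cast hD
    linarith [Real.exp_one_lt_d9]
  have hL : 1 ≤ ell2 D := by rw [ell2]; exact one_le_pow₀ hℓ1
  have h := Lemma53.continuous_delta514_line hL (t0 D) zero_lt_one
  simpa [deltaW] using h

/-- **The `|t| ≥ X` tail of `∫‖δ(1+it)‖dt`** (the form consumed by the `|t| > D` part of (7.14) and its
(14.5) analogue): for every `j : ℕ` there are `c, C` such that for all sufficiently large `D` (and every
real primitive `χ mod D`, vacuously) and every `X ≥ t₀^{1.03}`, `t ↦ δ(1+it)` is integrable on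
`{X ≤ |t|}` and `∫_{X ≤ |t|} ‖δ(1+it)‖ dt ≤ C·𝓛ᶜ·(t₀^{1.03})^{j+2}·X^{−j}`. Unconditional.
[cite: Zhang2022LandauSiegel, §5 Lemma 5.4 (i); §7 (7.14); §14 (14.5)] -/
theorem deltaW_tail_integral_le (j : ℕ) :
    ∃ c C : ℝ, ForAllLarge fun D _ _ => ∀ X : ℝ, t0 D ^ (1.03 : ℝ) ≤ X →
      IntegrableOn (fun t : ℝ => deltaW D (1 + t * I)) {t : ℝ | X ≤ |t|} ∧
        ∫ t in {t : ℝ | X ≤ |t|}, ‖deltaW D (1 + t * I)‖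
          ≤ C * ell D ^ c * (t0 D ^ (1.03 : ℝ)) ^ (j + 2) * X ^ (-(j : ℝ)) := by
  obtain ⟨c, C, D₀, h⟩ := deltaW_rapid_decay (j + 2)
  refine ⟨c, 2 * π * |C|, max D₀ 3, fun D _ χ hD hq hp X hX => ?_⟩
  have hD3 : 3 ≤ D := le_trans (le_max_right _ _) hD
  have hb := h D χ (le_trans (le_max_left _ _) hD) hq hp
  have hℓ1 : 1 ≤ ell D := by
    rw [ell, Real.le_log_iff_exp_le (by exact_mod_cast (show 0 < D by omega))]
    have h3 : (3 : ℝ) ≤ D := by exact_mod_cast hD3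
    linarith [Real.exp_one_lt_d9]
  have ht01 : 1 ≤ t0 D := one_le_pow₀ hℓ1
  have ht00 : 0 ≤ t0 D := zero_le_one.trans ht01
  have hT1 : 1 ≤ t0 D ^ (1.03 : ℝ) := Real.one_le_rpow ht01 (by norm_num)
  have hX1 : 1 ≤ X := hT1.trans hX
  set A : ℝ := |C| * ell D ^ c * (t0 D ^ (1.03 : ℝ)) ^ (j + 2) with hA
  have hℓc : 0 ≤ ell D ^ c := Real.rpow_nonneg (zero_le_one.trans hℓ1) _
  have hA0 : 0 ≤ A := by positivity
  have hpt : ∀ t : ℝ, X ≤ |t| → ‖deltaW D (1 + t * I)‖ ≤ A * |t| ^ (-((j + 2 : ℕ) : ℝ)) := by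
    intro t ht
    have ht0 : 0 < |t| := by linarith
    have h1 := hb t (hX.trans ht)
    have e : (t0 D ^ (1.03 : ℝ) / |t|) ^ (j + 2)
        = (t0 D ^ (1.03 : ℝ)) ^ (j + 2) * |t| ^ (-((j + 2 : ℕ) : ℝ)) := by
      rw [div_pow, Real.rpow_neg ht0.le, Real.rpow_natCast, div_eq_mul_inv]
    have hY : 0 ≤ ell D ^ c * (t0 D ^ (1.03 : ℝ) / |t|) ^ (j + 2) := by positivity
    calc ‖deltaW D (1 + t * I)‖ ≤ C * (ell D ^ c * (t0 D ^ (1.03 : ℝ) / |t|) ^ (j + 2)) := by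
          rw [← mul_assoc]; exact h1
      _ ≤ |C| * (ell D ^ c * (t0 D ^ (1.03 : ℝ) / |t|) ^ (j + 2)) :=
          mul_le_mul_of_nonneg_right (le_abs_self C) hY
      _ = A * |t| ^ (-((j + 2 : ℕ) : ℝ)) := by rw [e, hA]; ring
  have hmeas : AEStronglyMeasurable (fun t : ℝ => deltaW D (1 + t * I)) :=
    (continuous_deltaW_line hD3).aestronglyMeasurable
  obtain ⟨hint, hle⟩ := Lemma53.integrableOn_and_integral_norm_le_of_abs_ge hmeas hX1 hA0
    (by omega : 2 ≤ j + 2) hpt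
  refine ⟨hint, hle.trans (le_of_eq ?_)⟩
  rw [hA]
  push_cast
  rw [show (2 : ℝ) - ((j : ℝ) + 2) = -(j : ℝ) by ring]
  ring

/-- **`t ↦ δ(1+it)` is integrable on `ℝ`** for all large `D` (rapid decay off `[−t₀^{1.03}, t₀^{1.03}]`,
continuity on it): the `σ = 1` vertical integrability that Mellin inversion of (5.14) needs.
[cite: Zhang2022LandauSiegel, §5 (5.14); §7 (7.14)] -/
theorem integrable_deltaW_line :
    ForAllLarge fun D _ _ => Integrable fun t : ℝ => deltaW D (1 + t * I) := by
  obtain ⟨c, C, D₀, h⟩ := deltaW_tail_integral_le 0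
  refine ⟨max D₀ 3, fun D _ χ hD hq hp => ?_⟩
  have hD3 : 3 ≤ D := le_trans (le_max_right _ _) hD
  obtain ⟨hint, -⟩ := h D χ (le_trans (le_max_left _ _) hD) hq hp (t0 D ^ (1.03 : ℝ)) le_rfl
  have hIcc : IntegrableOn (fun t : ℝ => deltaW D (1 + t * I))
      (Icc (-(t0 D ^ (1.03 : ℝ))) (t0 D ^ (1.03 : ℝ))) :=
    (continuous_deltaW_line hD3).integrableOn_Icc
  have hU : {t : ℝ | t0 D ^ (1.03 : ℝ) ≤ |t|} ∪ Icc (-(t0 D ^ (1.03 : ℝ))) (t0 D ^ (1.03 : ℝ))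
      = univ := by
    ext t
    simp only [mem_union, mem_setOf_eq, mem_Icc, mem_univ, iff_true]
    rcases le_or_gt (t0 D ^ (1.03 : ℝ)) |t| with h1 | h1
    · exact Or.inl h1
    · exact Or.inr (abs_le.mp h1.le)
  show Integrable fun t : ℝ => deltaW D (1 + t * I)
  rw [← integrableOn_univ, ← hU]
  exact hint.union hIcc

/-- **Mellin inversion for `Δ` at `σ = 1`**: for all large `D` and every `x > 0`,
`Δ(x) = (1/2π) ∫ x^{−(1+it)} δ(1+it) dt` (Mathlib `mellinInv_mellin_eq`, with the vertical
integrability from `integrable_deltaW_line`) — the "By the Mellin transform" step behind (7.14) and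
(14.5), made exact. [cite: Zhang2022LandauSiegel, §5 (5.14); §7 (7.14)] -/
theorem DeltaW_eq_mellinInv :
    ForAllLarge fun D _ _ => ∀ x : ℝ, 0 < x →
      DeltaW D x = (1 / (2 * π)) • ∫ t : ℝ, (x : ℂ) ^ (-(1 + t * I)) • deltaW D (1 + t * I) := by
  obtain ⟨D₀, h⟩ := integrable_deltaW_line
  refine ⟨max D₀ 3, fun D _ χ hD hq hp x hx => ?_⟩
  have hD3 : 3 ≤ D := le_trans (le_max_right _ _) hD
  have hint := h D χ (le_trans (le_max_left _ _) hD) hq hp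
  have hℓ1 : 1 ≤ ell D := by
    rw [ell, Real.le_log_iff_exp_le (by exact_mod_cast (show 0 < D by omega))]
    have h3 : (3 : ℝ) ≤ D := by exact_mod_cast hD3
    linarith [Real.exp_one_lt_d9]
  have hL : 1 ≤ ell2 D := by rw [ell2]; exact one_le_pow₀ hℓ1
  have hmel : mellin (Lemma53.Delta510 (ell2 D) (t0 D)) = deltaW D := by
    funext s; rw [Lemma53.mellin_Delta510_eq]; rfl
  have hV : Complex.VerticalIntegrable (mellin (Lemma53.Delta510 (ell2 D) (t0 D))) 1 := by
    rw [Complex.VerticalIntegrable, hmel]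
    simpa using hint
  have key := mellinInv_mellin_eq 1 (Lemma53.Delta510 (ell2 D) (t0 D)) hx
    (Lemma53.mellinConvergent_Delta510 hL (t0 D) (by simp)) hV
    ((Lemma53.continuous_Delta510 (by linarith) (t0 D)).continuousAt)
  rw [DeltaW, Lemma53.Delta57_eq_Delta510 (by linarith) (t0 D) hx, ← key, mellinInv, hmel]
  simp

/-- **Lemma 5.4 (i) on the line `σ = 1`, at the manuscript's parameters**: `‖δ(1+it)‖ ≤ C·𝓛⁵¹⁹⁰/(1+t²)`
for all `t` and all `D ≥ 3` (the tree's explicit `Lemma53.norm_delta514_le_explicit`, d05, with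
`𝓛₂¹⁰ + t₀¹⁰ ≤ 2𝓛⁵¹⁹⁰`). [cite: Zhang2022LandauSiegel, §5 Lemma 5.4 (i)] -/
theorem norm_deltaW_line_le {D : ℕ} (hD : 3 ≤ D) (t : ℝ) :
    ‖deltaW D (1 + t * I)‖
      ≤ (2 * Lemma53.Jconst 1 2 + 4 * ((2 + Real.exp 1) * (4 * π) ^ 2 * Real.exp (((5 : ℕ) : ℝ) ^ 2)
          + (Real.exp 1 * ((2 * 5).factorial : ℝ) + 5 ^ 5) * Lemma53.Jconst 1 2))
        * ell D ^ 5190 * (1 + t ^ 2)⁻¹ := by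
  have hℓ1 : 1 ≤ ell D := by
    rw [ell, Real.le_log_iff_exp_le (by exact_mod_cast (show 0 < D by omega))]
    have h3 : (3 : ℝ) ≤ D := by exact_mod_cast hD
    linarith [Real.exp_one_lt_d9]
  have hL : 1 ≤ ell2 D := by rw [ell2]; exact one_le_pow₀ hℓ1
  have ht01 : 1 ≤ t0 D := one_le_pow₀ hℓ1
  have h := Lemma53.norm_delta514_le_explicit hL ht01 (s := 1 + t * I) (by norm_num) (by norm_num)
  have hns : ‖(1 : ℂ) + t * I‖ ^ 2 = 1 + t ^ 2 := by
    rw [Complex.sq_norm, Complex.normSq_apply]; simp; ring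
  rw [hns] at h
  set A : ℝ := (2 + Real.exp 1) * (4 * π) ^ 2 * Real.exp (((5 : ℕ) : ℝ) ^ 2)
      + (Real.exp 1 * ((2 * 5).factorial : ℝ) + 5 ^ 5) * Lemma53.Jconst 1 2 with hA
  have hJ0 : 0 ≤ Lemma53.Jconst 1 2 := Lemma53.Jconst_nonneg' 1 2
  have hA0 : 0 ≤ A := by positivity
  have hℓK : 1 ≤ ell D ^ 5190 := one_le_pow₀ hℓ1
  have hpow : ell2 D ^ (2 * 5) + t0 D ^ (2 * 5) ≤ 2 * ell D ^ 5190 := by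
    rw [ell2, t0, ← pow_mul, ← pow_mul]
    have : ell D ^ (400 * (2 * 5)) ≤ ell D ^ 5190 := pow_le_pow_right₀ hℓ1 (by norm_num)
    norm_num at this ⊢
    linarith
  have ht2 : 0 < 1 + t ^ 2 := by positivity
  calc ‖deltaW D (1 + t * I)‖ = ‖Lemma53.delta514 (ell2 D) (t0 D) (1 + t * I)‖ := rfl
    _ ≤ (2 * Lemma53.Jconst 1 2 + 2 * (A * (ell2 D ^ (2 * 5) + t0 D ^ (2 * 5)))) / (1 + t ^ 2) := h
    _ ≤ (2 * Lemma53.Jconst 1 2 + 4 * A) * ell D ^ 5190 / (1 + t ^ 2) := by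
        gcongr
        nlinarith [mul_le_mul_of_nonneg_left hpow hA0, mul_nonneg (mul_nonneg zero_le_two hJ0) (sub_nonneg.mpr hℓK)]
    _ = (2 * Lemma53.Jconst 1 2 + 4 * A) * ell D ^ 5190 * (1 + t ^ 2)⁻¹ := by
        rw [div_eq_mul_inv]

/-- **`∫_ℝ ‖δ(1+it)‖ dt ≤ C·𝓛⁵¹⁹⁰`** for `D ≥ 3` (`∫(1+t²)⁻¹ = π`). [cite: Zhang2022LandauSiegel, §5 Lemma 5.4 (i)] -/
theorem integral_norm_deltaW_line_le {D : ℕ} (hD : 3 ≤ D) :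
    ∫ t : ℝ, ‖deltaW D (1 + t * I)‖
      ≤ (2 * Lemma53.Jconst 1 2 + 4 * ((2 + Real.exp 1) * (4 * π) ^ 2 * Real.exp (((5 : ℕ) : ℝ) ^ 2)
          + (Real.exp 1 * ((2 * 5).factorial : ℝ) + 5 ^ 5) * Lemma53.Jconst 1 2))
        * ell D ^ 5190 * π := by
  set K : ℝ := (2 * Lemma53.Jconst 1 2 + 4 * ((2 + Real.exp 1) * (4 * π) ^ 2
      * Real.exp (((5 : ℕ) : ℝ) ^ 2) + (Real.exp 1 * ((2 * 5).factorial : ℝ) + 5 ^ 5)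
      * Lemma53.Jconst 1 2)) * ell D ^ 5190 with hK
  have hmaj : Integrable fun t : ℝ => K * (1 + t ^ 2)⁻¹ := integrable_inv_one_add_sq.const_mul K
  calc ∫ t : ℝ, ‖deltaW D (1 + t * I)‖ ≤ ∫ t : ℝ, K * (1 + t ^ 2)⁻¹ :=
        integral_mono_of_nonneg (Eventually.of_forall fun t => norm_nonneg _) hmaj
          (Eventually.of_forall fun t => norm_deltaW_line_le hD t)
    _ = K * π := by rw [integral_const_mul, integral_univ_inv_one_add_sq]

end Skeleton

end Literature.NumberTheory.LFunctions.Zhang2022
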